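import Literature.NumberTheory.Transcendental.KZProduct
import Literature.NumberTheory.Transcendental.LindemannWeierstrassProofs
import Summits.KontsevichZagierPeriods.KontsevichZagierPeriods.Theorems.SoloInformedRealParameterTransferCore
import Summits.KontsevichZagierPeriods.KontsevichZagierPeriods.Theorems.SoloInformedTameEquidecompVolume
import HarnessLib

/-!
# SoloInformed — tame Tarski circle squaring is impossible (COROLLARY SQ, kernel form)

Solo programme `solo-KontsevichZagierPeriods-informed`, session s138, file 4 of 4.  The programme's
`KZ_ℝ` METHOD BARRIER (VERDICT §4; `real-parameters.md`) says: the geometric three-move calculus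
with REAL-semialgebraic data proves no identity between `ℚ`-periods that is not already witnessed
by an algebraic number — because "these real parameters form a valid configuration of fixed shape"
is a first-order condition over `ℚ`, Tarski–Seidenberg moves a real solution to a real-algebraic
one, and rational polynomials take algebraic values at algebraic points.  Session s137 put the
engine in the kernel (`soloInformed_realParameter_barrier_core`); this file puts its sharpest
COROLLARY in the kernel, with no hypothesis left on paper:

* `soloInformed_isAlgebraic_volume_of_tameEquidecomp` — **THEOREM.** If a `ℚ`-semialgebraic set
  `D₀ ⊆ ℝⁿ` is partitioned into finitely many `ℝ`-semialgebraic pieces `A i` (any dimensions,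
  exact partition) which maps `x ↦ M_i x + b_i` with REAL matrices of determinant `±1` and REAL
  translation vectors carry onto an exact partition of a box `∏_j [0, a_j]` with REAL sides, then
  `vol(D₀)` is an algebraic number.
* `soloInformed_no_tame_circle_squaring` — **COROLLARY SQ.** The closed unit disc admits no such
  dissection onto any box (in particular onto the square of side `√π`): `vol = π` is transcendental
  (Lindemann, `transcendental_pi_holds`).

The group `{x ↦ M x + b : det M = ±1}` contains the isometries and is non-amenable, so no
Banach-type invariant-measure argument applies; with arbitrary pieces the disc IS equidecomposable
to the square by translations alone (Laczkovich 1990; with measurable / Borel / Jordan-measurable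
pieces: Grabowski–Máthé–Pikhurko 2017, Marks–Unger 2017, Máthé–Noel–Pikhurko).  The theorem says
the pieces of any such decomposition are never all semialgebraic — by a route (real-algebraic
parameter transfer + Lindemann) different from the boundary invariants of Dubins–Hirsch–Karush
(1963), which give the scissors-congruence case (Jordan pieces, isometries, `n = 2`).

Proof.  `soloInformed_isSemialgebraic_real_iff_fibre` presents each `A i` as the fibre of a
`ℚ`-semialgebraic family at a real vector; all real data (fibre parameters, matrix entries,
translations, sides) are collected into ONE real parameter `p₀` of the universal shape
`soloInformedTameShapeOf`, at which validity holds; validity is `ℚ`-semialgebraic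
(`SoloInformedTameShape.isSemialgebraic_setOf_valid`) and sound for the volume
(`SoloInformedTameShape.aeval_prod_side_eq_volume`); `soloInformed_realParameter_barrier_core`
(transported to a general finite index) concludes.

References: Tarski (1925); Dubins–Hirsch–Karush (1963); Laczkovich (1990); Bochnak–Coste–Roy
(1998) §2.2, §5; Basu–Pollack–Roy (2006) §2.5; Lindemann (1882).
-/

noncomputable section

namespace Summit.KontsevichZagierPeriods.KontsevichZagierPeriods.Theorems

open Set MvPolynomial MeasureTheory Literature.ModelTheory.ExponentialFields
  Literature.NumberTheory.Transcendental

/-- **The real-algebraic barrier core over any finite parameter index** (transport of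
`soloInformed_realParameter_barrier_core` along an enumeration). [cite: BochnakCosteRoy1998, §5.2] -/
theorem soloInformed_realParameter_barrier_core_fintype {K : Type*} [Fintype K]
    {Valid : (K → ℝ) → Prop} (hV : IsSemialgebraic ℚ {p | Valid p}) (value : MvPolynomial K ℚ)
    {τ : ℝ} (hsound : ∀ p, Valid p → aeval p value = τ) :
    (Transcendental ℚ τ → ∀ p, ¬ Valid p) ∧ ((∃ p, Valid p) → IsAlgebraic ℚ τ) := by
  classical
  have hV' : IsSemialgebraic ℚ {q : Fin (Fintype.card K) → ℝ | Valid (q ∘ Fintype.equivFin K)} :=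
    hV.preimage_comp (Fintype.equivFin K)
  have hsound' : ∀ q : Fin (Fintype.card K) → ℝ, Valid (q ∘ Fintype.equivFin K) →
      aeval q (rename (Fintype.equivFin K) value) = τ := fun q hq => by
    rw [aeval_rename]
    exact hsound _ hq
  have h := soloInformed_realParameter_barrier_core hV' (rename (Fintype.equivFin K) value) hsound'
  have hback : ∀ p : K → ℝ, (p ∘ (Fintype.equivFin K).symm) ∘ Fintype.equivFin K = p := fun p => by
    funext x
    simp only [Function.comp_apply, Equiv.symm_apply_apply]
  refine ⟨fun hτ p hp => h.1 hτ (p ∘ (Fintype.equivFin K).symm) ?_,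
    fun ⟨p, hp⟩ => h.2 ⟨p ∘ (Fintype.equivFin K).symm, ?_⟩⟩
  · show Valid ((p ∘ (Fintype.equivFin K).symm) ∘ Fintype.equivFin K)
    rw [hback]
    exact hp
  · show Valid ((p ∘ (Fintype.equivFin K).symm) ∘ Fintype.equivFin K)
    rw [hback]
    exact hp

section UniversalShape

variable {n N : ℕ} (m : Fin N → ℕ)

/-- The real-parameter index of the universal shape: fibre parameters of the pieces, matrix
entries, translation vectors, box sides. [folklore] -/
abbrev SoloInformedTameIdx (n N : ℕ) (m : Fin N → ℕ) : Type :=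
  (Σ i : Fin N, Fin (m i)) ⊕ ((Fin N × (Fin n × Fin n)) ⊕ ((Fin N × Fin n) ⊕ Fin n))

/-- The real parameter collecting all real data of a dissection. [folklore] -/
def soloInformedTameParam (c : ∀ i : Fin N, Fin (m i) → ℝ) (M : Fin N → Matrix (Fin n) (Fin n) ℝ)
    (b : Fin N → Fin n → ℝ) (a : Fin n → ℝ) : SoloInformedTameIdx n N m → ℝ :=
  Sum.elim (fun u => c u.1 u.2)
    (Sum.elim (fun v => M v.1 v.2.1 v.2.2) (Sum.elim (fun v => b v.1 v.2) a))

/-- The re-indexing `(uᵢ, x) ↦ ((i, uᵢ), x)` of the `i`-th fibre parameters. [folklore] -/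
def soloInformedTameEmb (i : Fin N) : Fin (m i) ⊕ Fin n → SoloInformedTameIdx n N m ⊕ Fin n :=
  Sum.map (fun u => Sum.inl ⟨i, u⟩) id

/-- **The universal shape**: pieces = the given `ℚ`-semialgebraic families re-indexed, matrices /
translations / sides = coordinate variables. [folklore] -/
def soloInformedTameShapeOf (S : ∀ i : Fin N, Set (Fin (m i) ⊕ Fin n → ℝ)) :
    SoloInformedTameShape (SoloInformedTameIdx n N m) n N where
  S := fun i => (fun v => v ∘ soloInformedTameEmb m i) ⁻¹' S i
  PM := fun i => Matrix.of fun r s => X (Sum.inr (Sum.inl (i, r, s)))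
  Pb := fun i t => X (Sum.inr (Sum.inr (Sum.inl (i, t))))
  Pa := fun j => X (Sum.inr (Sum.inr (Sum.inr j)))

variable {m} (S : ∀ i : Fin N, Set (Fin (m i) ⊕ Fin n → ℝ)) (c : ∀ i : Fin N, Fin (m i) → ℝ)
  (M : Fin N → Matrix (Fin n) (Fin n) ℝ) (b : Fin N → Fin n → ℝ) (a : Fin n → ℝ)

/-- The families of the universal shape are `ℚ`-semialgebraic. [cite: BochnakCosteRoy1998, §2.2] -/
theorem soloInformedTameShapeOf_isSemialgebraic (hS : ∀ i, IsSemialgebraic ℚ (S i)) (i : Fin N) :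
    IsSemialgebraic ℚ ((soloInformedTameShapeOf m S).S i) :=
  (hS i).preimage_comp (soloInformedTameEmb m i)

/-- The pieces of the universal shape at the collected parameter are the given fibres. [folklore] -/
theorem soloInformedTameShapeOf_piece (i : Fin N) :
    (soloInformedTameShapeOf m S).piece i (soloInformedTameParam m c M b a) =
      {x | Sum.elim (c i) x ∈ S i} := by
  ext x
  have h : Sum.elim (soloInformedTameParam m c M b a) x ∘ soloInformedTameEmb m i =
      Sum.elim (c i) x := by
    funext t
    cases t with
    | inl u => rfl
    | inr s => rfl
  simp only [SoloInformedTameShape.piece, soloInformedTameShapeOf, mem_setOf_eq, mem_preimage, h]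

/-- The matrices of the universal shape at the collected parameter. [folklore] -/
theorem soloInformedTameShapeOf_mat (i : Fin N) :
    (soloInformedTameShapeOf m S).mat i (soloInformedTameParam m c M b a) = M i := by
  ext r s
  simp only [SoloInformedTameShape.mat, soloInformedTameShapeOf, Matrix.map_apply, Matrix.of_apply,
    aeval_X, soloInformedTameParam, Sum.elim_inr, Sum.elim_inl]

/-- The translation vectors of the universal shape at the collected parameter. [folklore] -/
theorem soloInformedTameShapeOf_shift (i : Fin N) :
    (soloInformedTameShapeOf m S).shift i (soloInformedTameParam m c M b a) = b i := by
  funext t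
  simp only [SoloInformedTameShape.shift, soloInformedTameShapeOf, aeval_X, soloInformedTameParam,
    Sum.elim_inr, Sum.elim_inl]

/-- The box sides of the universal shape at the collected parameter. [folklore] -/
theorem soloInformedTameShapeOf_side :
    (soloInformedTameShapeOf m S).side (soloInformedTameParam m c M b a) = a := by
  funext j
  simp only [SoloInformedTameShape.side, soloInformedTameShapeOf, aeval_X, soloInformedTameParam,
    Sum.elim_inr]

/-- The inverse maps of the universal shape at the collected parameter. [folklore] -/
theorem soloInformedTameShapeOf_inv (i : Fin N) :
    (soloInformedTameShapeOf m S).inv i (soloInformedTameParam m c M b a) =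
      soloInformedAffInv (M i) (b i) := by
  funext y
  simp only [SoloInformedTameShape.inv, soloInformedTameShapeOf_mat, soloInformedTameShapeOf_shift]

end UniversalShape

/-- **THEOREM (tame equidecompositions compute only algebraic volumes).** Let `D₀ ⊆ ℝⁿ` be
`ℚ`-semialgebraic, exactly partitioned into finitely many `ℝ`-semialgebraic pieces `A i`; let real
matrices `M i` with `det (M i)² = 1` and real vectors `b i` be given such that the images
`M i • A i + b i` exactly partition the box `∏_j [0, a_j]` (`a_j ≥ 0` real).  Then `vol(D₀)` is an
algebraic number. [cite: BochnakCosteRoy1998, §5.2] -/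
theorem soloInformed_isAlgebraic_volume_of_tameEquidecomp {n N : ℕ} {D₀ : Set (Fin n → ℝ)}
    (hD₀ : IsSemialgebraic ℚ D₀) {A : Fin N → Set (Fin n → ℝ)} (hA : ∀ i, IsSemialgebraic ℝ (A i))
    {M : Fin N → Matrix (Fin n) (Fin n) ℝ} (hM : ∀ i, (M i).det ^ 2 = 1) (b : Fin N → Fin n → ℝ)
    {a : Fin n → ℝ} (ha : ∀ j, 0 ≤ a j)
    (hcover : ⋃ i, A i = D₀) (hdisj : Pairwise (Function.onFun Disjoint A))
    (hcover' : ⋃ i, (fun x => (M i).mulVec x + b i) '' A i =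
      Set.pi Set.univ fun j => Set.Icc 0 (a j))
    (hdisj' : Pairwise (Function.onFun Disjoint fun i => (fun x => (M i).mulVec x + b i) '' A i)) :
    IsAlgebraic ℚ (volume D₀).toReal := by
  classical
  choose m c S hS hAS using fun i => soloInformed_isSemialgebraic_real_iff_fibre.1 (hA i)
  have hSσ : ∀ i, IsSemialgebraic ℚ ((soloInformedTameShapeOf m S).S i) :=
    soloInformedTameShapeOf_isSemialgebraic S hS
  have hpiece : ∀ i, (soloInformedTameShapeOf m S).piece i (soloInformedTameParam m c M b a) = A i :=
    fun i => by rw [soloInformedTameShapeOf_piece, ← hAS i]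
  have himg : ∀ i, (fun x => (M i).mulVec x + b i) '' A i = soloInformedAffInv (M i) (b i) ⁻¹' A i :=
    fun i => soloInformed_image_equiAffine_eq_preimage _ (hM i) _ _
  have hV : (soloInformedTameShapeOf m S).Valid D₀ (soloInformedTameParam m c M b a) := by
    refine (soloInformedTameShapeOf m S).valid_iff.2 ⟨fun i => ?_, fun j => ?_, fun z => ⟨?_, ?_, ?_, ?_⟩⟩
    · rw [soloInformedTameShapeOf_mat]
      exact hM i
    · rw [soloInformedTameShapeOf_side]
      exact ha j
    · simp only [hpiece]
      rw [← hcover, mem_iUnion]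
    · intro i j hij hzi hzj
      rw [hpiece] at hzi hzj
      exact Set.disjoint_left.1 (hdisj hij) hzi hzj
    · simp only [hpiece, soloInformedTameShapeOf_inv, soloInformedTameShapeOf_side]
      show z ∈ Set.pi Set.univ (fun j => Set.Icc 0 (a j)) ↔ _
      rw [← hcover', mem_iUnion]
      simp only [himg, mem_preimage]
    · intro i j hij hzi hzj
      rw [hpiece, soloInformedTameShapeOf_inv] at hzi hzj
      have hd := hdisj' hij
      simp only [Function.onFun, himg] at hd
      exact Set.disjoint_left.1 hd hzi hzj
  exact (soloInformed_realParameter_barrier_core_fintype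
    ((soloInformedTameShapeOf m S).isSemialgebraic_setOf_valid hSσ hD₀)
    (∏ j, (soloInformedTameShapeOf m S).Pa j)
    (fun p hp => (soloInformedTameShapeOf m S).aeval_prod_side_eq_volume hSσ hp)).2 ⟨_, hV⟩

/-- **COROLLARY SQ (tame Tarski circle squaring is impossible).** The closed unit disc is not
equidecomposable — with finitely many `ℝ`-semialgebraic pieces of any dimensions, exact partitions,
and maps `x ↦ M x + b` with real `det M = ±1` (in particular isometries) — to any box, in
particular not to the square of side `√π`: its volume `π` is transcendental (Lindemann 1882).
[cite: Lindemann1882] -/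
theorem soloInformed_no_tame_circle_squaring {N : ℕ} {A : Fin N → Set (Fin 2 → ℝ)}
    (hA : ∀ i, IsSemialgebraic ℝ (A i)) {M : Fin N → Matrix (Fin 2) (Fin 2) ℝ}
    (hM : ∀ i, (M i).det ^ 2 = 1) (b : Fin N → Fin 2 → ℝ) {a : Fin 2 → ℝ} (ha : ∀ j, 0 ≤ a j)
    (hcover : ⋃ i, A i = KZ.piDisc) (hdisj : Pairwise (Function.onFun Disjoint A))
    (hcover' : ⋃ i, (fun x => (M i).mulVec x + b i) '' A i =
      Set.pi Set.univ fun j => Set.Icc 0 (a j))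
    (hdisj' : Pairwise (Function.onFun Disjoint fun i => (fun x => (M i).mulVec x + b i) '' A i)) :
    False := by
  have h := soloInformed_isAlgebraic_volume_of_tameEquidecomp KZ.isSemialgebraic_piDisc hA hM b ha
    hcover hdisj hcover' hdisj'
  rw [KZ.volume_piDisc, ENNReal.toReal_ofReal Real.pi_pos.le] at h
  exact transcendental_pi_holds h

/-- **COROLLARY (every tame equidecomposition class of a box has algebraic volume)**, stated for an
`ℝ`-semialgebraic source that happens to be `ℚ`-semialgebraic and a transcendental volume: no tame
equi-affine dissection onto a box exists. [cite: BochnakCosteRoy1998, §5.2] -/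
theorem soloInformed_no_tameEquidecomp_of_transcendental_volume {n N : ℕ} {D₀ : Set (Fin n → ℝ)}
    (hD₀ : IsSemialgebraic ℚ D₀) (hτ : Transcendental ℚ (volume D₀).toReal)
    {A : Fin N → Set (Fin n → ℝ)} (hA : ∀ i, IsSemialgebraic ℝ (A i))
    {M : Fin N → Matrix (Fin n) (Fin n) ℝ} (hM : ∀ i, (M i).det ^ 2 = 1) (b : Fin N → Fin n → ℝ)
    {a : Fin n → ℝ} (ha : ∀ j, 0 ≤ a j)
    (hcover : ⋃ i, A i = D₀) (hdisj : Pairwise (Function.onFun Disjoint A))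
    (hcover' : ⋃ i, (fun x => (M i).mulVec x + b i) '' A i =
      Set.pi Set.univ fun j => Set.Icc 0 (a j))
    (hdisj' : Pairwise (Function.onFun Disjoint fun i => (fun x => (M i).mulVec x + b i) '' A i)) :
    False :=
  hτ (soloInformed_isAlgebraic_volume_of_tameEquidecomp hD₀ hA hM b ha hcover hdisj hcover' hdisj')

end Summit.KontsevichZagierPeriods.KontsevichZagierPeriods.Theorems
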